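import Literature.MathematicalPhysics.QuantumLattice.SplitPairShiftedWickDeterminant
import Literature.MathematicalPhysics.QuantumLattice.ShiftedHubbardTwoTimeDyson
import HarnessLib

/-!
# The two-time Dyson coefficients of the shifted Hubbard two-point function are (minus) split-pair shifted determinants

Topic `MathematicalPhysics/QuantumLattice`; joins `ShiftedHubbardTwoTimeDyson` (the operator-level two-time series, coefficients
`Tr(e^{−βdΓh}· c_{yσ′} · ∏_i Ṽ_{x_i}(τ_i) · a⁺_{xσ}(τ_X) · ∏_l Ṽ_{x′_l}(τ′_l))`) with `SplitPairShiftedWickDeterminant` (the shifted split-pair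
Wick theorem, block form).  Result: the free expectation of that word is `−det(splitPairMatrix − diagonal(0, ν, ν, …))` with the
`2k + 2j` shifted pairs (vertex `a`, spin `ς` ↦ pair `2a + ς`), the inserted creation letter `a⁺_{xσ}(τ_X)` and the leading `c_{yσ′}`
— BGM 2006 §2.1 (2.8) at unequal times with the counterterm `ν` on the diagonal of the pair block.

* `creVec`, `annVec` (letter vectors of evolved operators), `gibbsState_dGamma_creVec_annVec` / `_annVec_creVec` (closed Fermi-matrix
  forms of the letter-pair expectations — the entries of the split-pair matrix via its entry table);
* `hasSum_hubbard_twoPoint_twoTime_renormalised_det` — the two-time renormalised series in determinant form;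
* `splitPairMatrix_evolved_zero_zero/_zero_succ/_succ_zero/_succ_succ` — the entries of the split-pair matrix of evolved letters in
  closed Fermi-matrix form (generic one-body `h`);
* **`gibbsState_dGamma_twoTime_shiftedHubbardWord_eq_neg_det`** — the identification, on any finite vertex set `Λ` (one-body matrix on `Orb Λ`).

## References
* G. Benfatto, A. Giuliani, V. Mastropietro, Ann. Henri Poincaré 7 (2006) 809–898, §2.1 (2.8), §2. [BenfattoGiulianiMastropietro2006]
* M. Gaudin, Nucl. Phys. 15 (1960) 89. [Gaudin1960]
-/

noncomputable section

namespace Literature.MathematicalPhysics.QuantumLattice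

open NormedSpace Matrix Finset
open scoped ComplexOrder

section Letters

variable {ι : Type*} [LinearOrder ι] [Fintype ι]

/-- The creation-letter vector of an evolved creation operator: `e^{τdΓ(h)} c†_i e^{−τdΓ(h)} = c†(k ↦ (e^{τh})_{ki})`. [folklore] -/
def creVec (h : Matrix ι ι ℂ) (τ : ℂ) (i : ι) : ι → ℂ := fun k => exp (τ • h) k i

/-- The annihilation-letter vector of an evolved annihilation operator: `e^{τdΓ(h)} c_j e^{−τdΓ(h)} = c(k ↦ (e^{−τh})_{jk})`. [folklore] -/
def annVec (h : Matrix ι ι ℂ) (τ : ℂ) (j : ι) : ι → ℂ := fun k => exp (-(τ • h)) j k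

/-- Evolved creation operator as a linear letter. [cite: BenfattoGiulianiMastropietro2006, §1.2 (1.2)] -/
theorem exp_conj_creation_eq_linLetterOp_creVec (h : Matrix ι ι ℂ) (τ : ℂ) (i : ι) :
    exp (τ • dGamma h) * creation i * exp (-(τ • dGamma h)) = linLetterOp (creVec h τ i, true) :=
  exp_dGamma_conj_creation_eq_linLetterOp h τ i

/-- Evolved annihilation operator as a linear letter. [cite: BenfattoGiulianiMastropietro2006, §1.2 (1.2)] -/
theorem exp_conj_annihilation_eq_linLetterOp_annVec (h : Matrix ι ι ℂ) (τ : ℂ) (j : ι) :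
    exp (τ • dGamma h) * annihilation j * exp (-(τ • dGamma h)) = linLetterOp (annVec h τ j, false) :=
  exp_dGamma_conj_annihilation_eq_linLetterOp h τ j

/-- A bare annihilation operator is the time-`0` letter. [cite: BenfattoGiulianiMastropietro2006, §1.2 (1.2)] -/
theorem annihilation_eq_linLetterOp_annVec_zero (h : Matrix ι ι ℂ) (j : ι) :
    annihilation j = linLetterOp (annVec h 0 j, false) := by
  rw [← exp_conj_annihilation_eq_linLetterOp_annVec]
  simp

/-- Closed form of the letter-pair expectation, creation letter first: `⟨a⁺_i(τ) a⁻_j(τ′)⟩ = [e^{−τ′h}(1+e^{βh})⁻¹e^{τh}]_{ji}`.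
[cite: BenfattoGiulianiMastropietro2006, §1.2 (1.4)] -/
theorem gibbsState_dGamma_creVec_annVec {h : Matrix ι ι ℂ} (hh : h.IsHermitian) (β : ℝ) (τ τ' : ℂ) (i j : ι) :
    gibbsState β (dGamma h) (linLetterOp (creVec h τ i, true) * linLetterOp (annVec h τ' j, false)) =
      (exp (-(τ' • h)) * (1 + exp ((β : ℂ) • h))⁻¹ * exp (τ • h)) j i := by
  rw [← exp_conj_creation_eq_linLetterOp_creVec, ← exp_conj_annihilation_eq_linLetterOp_annVec]
  exact thermalCorr_dGamma_evolve_creation_annihilation hh β τ' τ i j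

/-- Closed form of the letter-pair expectation, annihilation letter first: `⟨a⁻_j(τ′) a⁺_i(τ)⟩ = [e^{−τ′h}(1+e^{−βh})⁻¹e^{τh}]_{ji}`.
[cite: BenfattoGiulianiMastropietro2006, §1.2 (1.4)] -/
theorem gibbsState_dGamma_annVec_creVec {h : Matrix ι ι ℂ} (hh : h.IsHermitian) (β : ℝ) (τ τ' : ℂ) (i j : ι) :
    gibbsState β (dGamma h) (linLetterOp (annVec h τ' j, false) * linLetterOp (creVec h τ i, true)) =
      (exp (-(τ' • h)) * (1 + exp (-((β : ℂ) • h)))⁻¹ * exp (τ • h)) j i := by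
  rw [← exp_conj_creation_eq_linLetterOp_creVec, ← exp_conj_annihilation_eq_linLetterOp_annVec]
  exact thermalCorr_dGamma_evolve_annihilation_creation hh β τ' τ i j

end Letters

section Hubbard

variable {Λ : Type*} [LinearOrder Λ] [Fintype Λ]

/-- **The two-time Dyson coefficients are split-pair shifted determinants.**  For a Hermitian one-body matrix `h` on `Orb Λ`, real `β`,
vertex sites `f : Fin k → Λ`, `f′ : Fin j → Λ` with complex pair times `τ, τ′`, an inserted creation letter `a⁺_{xσ}(τ_X)`, the
leading annihilation letter `c_{yσ′}` and shifts `ν₀, ν₁`: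
`⟨c_{yσ′} · ∏_i Ṽ_{f i}(τ_i) · a⁺_{xσ}(τ_X) · ∏_l Ṽ_{f′ l}(τ′_l)⟩_{β,dΓ(h)} = −det(splitPairMatrix β h (2k) (2k+2j) F G − diagonal(0, ν_ς…))`,
`Ṽ_z(τ) = (a⁺_{z↑}(τ)a⁻_{z↑}(τ) − ν₀)(a⁺_{z↓}(τ)a⁻_{z↓}(τ) − ν₁)`, with the letter vectors `F` (creations by word position) and `G`
(`c_{yσ′}` first, then the pair annihilations). [cite: BenfattoGiulianiMastropietro2006, §2.1 (2.8)] -/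
theorem gibbsState_dGamma_twoTime_shiftedHubbardWord_eq_neg_det {h : Matrix (Orb Λ) (Orb Λ) ℂ} (hh : h.IsHermitian) (β : ℝ)
    {k j : ℕ} (f : Fin k → Λ) (τ : Fin k → ℂ) (f' : Fin j → Λ) (τ' : Fin j → ℂ) (x y : Λ) (σ σ' : Fin 2) (τX : ℂ) (ν : Fin 2 → ℂ) :
    gibbsState β (dGamma h)
        (annihilation (orb y σ') *
          ((List.ofFn fun i : Fin k =>
              ((exp (τ i • dGamma h) * creation (orb (f i) 0) * exp (-(τ i • dGamma h))) *
                    (exp (τ i • dGamma h) * annihilation (orb (f i) 0) * exp (-(τ i • dGamma h))) -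
                  ν 0 • (1 : Matrix (Finset (Orb Λ)) (Finset (Orb Λ)) ℂ)) *
                ((exp (τ i • dGamma h) * creation (orb (f i) 1) * exp (-(τ i • dGamma h))) *
                    (exp (τ i • dGamma h) * annihilation (orb (f i) 1) * exp (-(τ i • dGamma h))) -
                  ν 1 • (1 : Matrix (Finset (Orb Λ)) (Finset (Orb Λ)) ℂ))).prod *
            (exp (τX • dGamma h) * creation (orb x σ) * exp (-(τX • dGamma h))) *
            (List.ofFn fun l : Fin j =>
              ((exp (τ' l • dGamma h) * creation (orb (f' l) 0) * exp (-(τ' l • dGamma h))) *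
                    (exp (τ' l • dGamma h) * annihilation (orb (f' l) 0) * exp (-(τ' l • dGamma h))) -
                  ν 0 • (1 : Matrix (Finset (Orb Λ)) (Finset (Orb Λ)) ℂ)) *
                ((exp (τ' l • dGamma h) * creation (orb (f' l) 1) * exp (-(τ' l • dGamma h))) *
                    (exp (τ' l • dGamma h) * annihilation (orb (f' l) 1) * exp (-(τ' l • dGamma h))) -
                  ν 1 • (1 : Matrix (Finset (Orb Λ)) (Finset (Orb Λ)) ℂ))).prod)) =
      -(splitPairMatrix β h (k * 2) (k * 2 + j * 2) (Nat.le_add_right _ _)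
            (Fin.append (m := k * 2) (n := j * 2 + 1)
              (fun m : Fin (k * 2) => creVec h (τ (finProdFinEquiv.symm m).1) (orb (f (finProdFinEquiv.symm m).1) (finProdFinEquiv.symm m).2))
              (Fin.cons (creVec h τX (orb x σ))
                (fun m : Fin (j * 2) => creVec h (τ' (finProdFinEquiv.symm m).1) (orb (f' (finProdFinEquiv.symm m).1) (finProdFinEquiv.symm m).2)) :
                  Fin (j * 2 + 1) → Orb Λ → ℂ) : Fin (k * 2 + j * 2 + 1) → Orb Λ → ℂ)
            (Fin.cons (annVec h 0 (orb y σ'))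
              (Fin.append
                (fun m : Fin (k * 2) => annVec h (τ (finProdFinEquiv.symm m).1) (orb (f (finProdFinEquiv.symm m).1) (finProdFinEquiv.symm m).2))
                (fun m : Fin (j * 2) => annVec h (τ' (finProdFinEquiv.symm m).1) (orb (f' (finProdFinEquiv.symm m).1) (finProdFinEquiv.symm m).2))) :
                Fin (k * 2 + j * 2 + 1) → Orb Λ → ℂ) -
          Matrix.diagonal (Fin.cons 0 (Fin.append (fun m : Fin (k * 2) => ν (finProdFinEquiv.symm m).2)
            (fun m : Fin (j * 2) => ν (finProdFinEquiv.symm m).2)) : Fin (k * 2 + j * 2 + 1) → ℂ)).det := by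
  rw [← gibbsState_dGamma_splitPairBlockWordShift_eq_neg_det hh β]
  -- regroup each block of `2k` / `2j` shifted pairs into vertices
  rw [prod_ofFn_mul_two k, prod_ofFn_mul_two j]
  simp only [Equiv.symm_apply_apply, exp_conj_creation_eq_linLetterOp_creVec, exp_conj_annihilation_eq_linLetterOp_annVec,
    annihilation_eq_linLetterOp_annVec_zero h (orb y σ')]

variable (G : SimpleGraph Λ) [DecidableRel G.Adj]

/-- **The renormalised two-time perturbation series of the Hubbard two-point function in DETERMINANT form (finite volume).**  For real
`β > 0`, `t, U, μ, ν` and `0 ≤ s ≤ β`, with `h = hubbardOneBody G t μ`, `Z₀ = Tr e^{−βdΓ(h)}`: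
`e^{−βUν²|Λ|} · Tr(e^{−(β−s)(H(t,U)−(μ+Uν)N)} c†_{xσ} e^{−s(…)} c_{yσ′})
   = Σ_N U^N Σ_{k+j=N} ∫_{Δ_k(1−s/β)}∫_{Δ_j(s/β)} (−β)^N Σ_{x⃗,x⃗′} Z₀ · (−det(splitPairMatrix − diagonal(0,ν,…,ν)))`,
the split-pair propagator matrix of the word `c_{yσ′}(0) · ∏_i Ṽ_{x_i}(−βu_i) · a⁺_{xσ}(−(β−s)) · ∏_l Ṽ_{x′_l}(−(β−s)−βu′_l)`.
The two-time companion of `hasSum_hubbard_twoPoint_renormalised_det`. [cite: BenfattoGiulianiMastropietro2006, §2.1 (2.8)] -/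
theorem hasSum_hubbard_twoPoint_twoTime_renormalised_det {β : ℝ} (hβ : 0 < β) (t U μ ν : ℝ) (x y : Λ) (σ σ' : Fin 2)
    {s : ℝ} (hs0 : 0 ≤ s) (hsβ : s ≤ β) :
    HasSum (fun N : ℕ => (U : ℂ) ^ N * ∑ kj ∈ antidiagonal N,
        orderedIntegral kj.1 (fun u : Fin kj.1 → ℝ =>
          orderedIntegral kj.2 (fun u' : Fin kj.2 → ℝ =>
            (-(β : ℂ)) ^ (kj.1 + kj.2) * ∑ f : Fin kj.1 → Λ, ∑ f' : Fin kj.2 → Λ,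
              Matrix.partitionFn β (dGamma (hubbardOneBody G t μ)) *
              -(splitPairMatrix β (hubbardOneBody G t μ) (kj.1 * 2) (kj.1 * 2 + kj.2 * 2) (Nat.le_add_right _ _)
                  (Fin.append (m := kj.1 * 2) (n := kj.2 * 2 + 1)
                    (fun m : Fin (kj.1 * 2) => creVec (hubbardOneBody G t μ) ((((u (finProdFinEquiv.symm m).1 : ℝ) : ℂ)) * -(β : ℂ))
                      (orb (f (finProdFinEquiv.symm m).1) (finProdFinEquiv.symm m).2))
                    (Fin.cons (creVec (hubbardOneBody G t μ) (((((β - s) / β : ℝ) : ℂ)) * -(β : ℂ)) (orb x σ))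
                      (fun m : Fin (kj.2 * 2) => creVec (hubbardOneBody G t μ)
                        (((((β - s) / β + u' (finProdFinEquiv.symm m).1 : ℝ) : ℂ)) * -(β : ℂ))
                        (orb (f' (finProdFinEquiv.symm m).1) (finProdFinEquiv.symm m).2)) :
                        Fin (kj.2 * 2 + 1) → Orb Λ → ℂ) : Fin (kj.1 * 2 + kj.2 * 2 + 1) → Orb Λ → ℂ)
                  (Fin.cons (annVec (hubbardOneBody G t μ) 0 (orb y σ'))
                    (Fin.append
                      (fun m : Fin (kj.1 * 2) => annVec (hubbardOneBody G t μ) ((((u (finProdFinEquiv.symm m).1 : ℝ) : ℂ)) * -(β : ℂ))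
                        (orb (f (finProdFinEquiv.symm m).1) (finProdFinEquiv.symm m).2))
                      (fun m : Fin (kj.2 * 2) => annVec (hubbardOneBody G t μ)
                        (((((β - s) / β + u' (finProdFinEquiv.symm m).1 : ℝ) : ℂ)) * -(β : ℂ))
                        (orb (f' (finProdFinEquiv.symm m).1) (finProdFinEquiv.symm m).2))) :
                      Fin (kj.1 * 2 + kj.2 * 2 + 1) → Orb Λ → ℂ) -
                Matrix.diagonal (Fin.cons 0 (Fin.append (fun _ : Fin (kj.1 * 2) => (ν : ℂ)) (fun _ : Fin (kj.2 * 2) => (ν : ℂ))) :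
                  Fin (kj.1 * 2 + kj.2 * 2 + 1) → ℂ)).det)
            (s / β)) ((β - s) / β))
      ((Real.exp (-(β * (U * ν ^ 2 * Fintype.card Λ))) : ℂ) *
        (Matrix.gibbsWeight (β - s) (hamiltonianWith G t U (μ + U * ν)) * creation (orb x σ) *
          (Matrix.gibbsWeight s (hamiltonianWith G t U (μ + U * ν)) * annihilation (orb y σ'))).trace) := by
  haveI : Nonempty (Finset (Orb Λ)) := ⟨∅⟩
  have hZ : Matrix.partitionFn β (dGamma (hubbardOneBody G t μ)) ≠ 0 :=
    (Matrix.partitionFn_pos β (isHermitian_dGamma (isHermitian_hubbardOneBody G t μ))).ne'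
  have hs := hasSum_hubbard_twoPoint_twoTime_renormalised_trace G hβ t U μ ν x y σ σ' hs0 hsβ
  refine hs.congr_fun fun N => ?_
  refine congrArg (fun S => (U : ℂ) ^ N * S) (Finset.sum_congr rfl fun kj _ => ?_)
  refine congrArg (fun F => orderedIntegral kj.1 F ((β - s) / β)) (funext fun u => ?_)
  refine congrArg (fun F => orderedIntegral kj.2 F (s / β)) (funext fun u' => ?_)
  refine congrArg (fun S => (-(β : ℂ)) ^ (kj.1 + kj.2) * S) (Finset.sum_congr rfl fun f _ => Finset.sum_congr rfl fun f' _ => ?_)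
  rw [← gibbsState_dGamma_twoTime_shiftedHubbardWord_eq_neg_det (isHermitian_hubbardOneBody G t μ) β f
    (fun i => ((u i : ℝ) : ℂ) * -(β : ℂ)) f' (fun l => ((((β - s) / β + u' l : ℝ) : ℂ)) * -(β : ℂ)) x y σ σ' _ (fun _ => (ν : ℂ)),
    Matrix.gibbsState_apply, mul_inv_cancel_left₀ hZ]

end Hubbard

section ClosedForms

variable {ι : Type*} [LinearOrder ι] [Fintype ι] {h : Matrix ι ι ℂ} (hh : h.IsHermitian) (β : ℝ) (K n : ℕ) (hK : K ≤ n)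
  (oc : Fin (n + 1) → ι) (τc : Fin (n + 1) → ℂ) (oa : Fin (n + 1) → ι) (τa : Fin (n + 1) → ℂ)
include hh

/-- Closed form of the `(0,0)` entry of the split-pair matrix of evolved letters (creation `oc_K` at `τc_K`, annihilation `oa₀` at `τa₀`,
annihilation FIRST): `−[e^{−τa₀h}(1+e^{−βh})⁻¹e^{τc_K h}]_{oa₀, oc_K}`. [cite: BenfattoGiulianiMastropietro2006, §1.2 (1.4)] -/
theorem splitPairMatrix_evolved_zero_zero :
    splitPairMatrix β h K n hK (fun i => creVec h (τc i) (oc i)) (fun b => annVec h (τa b) (oa b)) 0 0 =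
      -(exp (-(τa 0 • h)) * (1 + exp (-((β : ℂ) • h)))⁻¹ * exp (τc ⟨K, Nat.lt_succ_of_le hK⟩ • h)) (oa 0)
        (oc ⟨K, Nat.lt_succ_of_le hK⟩) := by
  rw [splitPairMatrix_zero_zero, gibbsState_dGamma_annVec_creVec hh]

/-- Closed form of the `(0, m+1)` entries: creation `oc_K` before the annihilation of pair `m` iff `K ≤ m`.
[cite: BenfattoGiulianiMastropietro2006, §1.2 (1.4)] -/
theorem splitPairMatrix_evolved_zero_succ (m : Fin n) :
    splitPairMatrix β h K n hK (fun i => creVec h (τc i) (oc i)) (fun b => annVec h (τa b) (oa b)) 0 m.succ =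
      if K ≤ (m : ℕ) then
        (exp (-(τa m.succ • h)) * (1 + exp ((β : ℂ) • h))⁻¹ * exp (τc ⟨K, Nat.lt_succ_of_le hK⟩ • h)) (oa m.succ)
          (oc ⟨K, Nat.lt_succ_of_le hK⟩)
      else -(exp (-(τa m.succ • h)) * (1 + exp (-((β : ℂ) • h)))⁻¹ * exp (τc ⟨K, Nat.lt_succ_of_le hK⟩ • h)) (oa m.succ)
          (oc ⟨K, Nat.lt_succ_of_le hK⟩) := by
  rw [splitPairMatrix_zero_succ]
  split_ifs
  · rw [gibbsState_dGamma_creVec_annVec hh]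
  · rw [gibbsState_dGamma_annVec_creVec hh]

/-- Closed form of the `(m+1, 0)` entries (the leading annihilation letter precedes every pair creation):
`−[e^{−τa₀h}(1+e^{−βh})⁻¹e^{τc h}]_{oa₀, oc(K.succAbove m)}`. [cite: BenfattoGiulianiMastropietro2006, §1.2 (1.4)] -/
theorem splitPairMatrix_evolved_succ_zero (m : Fin n) :
    splitPairMatrix β h K n hK (fun i => creVec h (τc i) (oc i)) (fun b => annVec h (τa b) (oa b)) m.succ 0 =
      -(exp (-(τa 0 • h)) * (1 + exp (-((β : ℂ) • h)))⁻¹ *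
          exp (τc ((⟨K, Nat.lt_succ_of_le hK⟩ : Fin (n + 1)).succAbove m) • h)) (oa 0)
        (oc ((⟨K, Nat.lt_succ_of_le hK⟩ : Fin (n + 1)).succAbove m)) := by
  rw [splitPairMatrix_succ_zero, gibbsState_dGamma_annVec_creVec hh]

/-- Closed form of the `(m+1, m'+1)` entries (the `propMatrix` rule on pair indices). [cite: BenfattoGiulianiMastropietro2006, §1.2 (1.4)] -/
theorem splitPairMatrix_evolved_succ_succ (m m' : Fin n) :
    splitPairMatrix β h K n hK (fun i => creVec h (τc i) (oc i)) (fun b => annVec h (τa b) (oa b)) m.succ m'.succ =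
      if m ≤ m' then
        (exp (-(τa m'.succ • h)) * (1 + exp ((β : ℂ) • h))⁻¹ *
          exp (τc ((⟨K, Nat.lt_succ_of_le hK⟩ : Fin (n + 1)).succAbove m) • h)) (oa m'.succ)
          (oc ((⟨K, Nat.lt_succ_of_le hK⟩ : Fin (n + 1)).succAbove m))
      else -(exp (-(τa m'.succ • h)) * (1 + exp (-((β : ℂ) • h)))⁻¹ *
          exp (τc ((⟨K, Nat.lt_succ_of_le hK⟩ : Fin (n + 1)).succAbove m) • h)) (oa m'.succ)
          (oc ((⟨K, Nat.lt_succ_of_le hK⟩ : Fin (n + 1)).succAbove m)) := by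
  rw [splitPairMatrix_succ_succ]
  split_ifs
  · rw [gibbsState_dGamma_creVec_annVec hh]
  · rw [gibbsState_dGamma_annVec_creVec hh]

end ClosedForms

end Literature.MathematicalPhysics.QuantumLattice

end
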